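import Summits.BirchSwinnertonDyer.BirchSwinnertonDyer.Theorems.ThetaPartnerAtTwoSignedControlAtTwoShaThreeBaseBrauerDivisible
import Literature.NumberTheory.GaloisRepresentations.IdeleClassBarBoundaryPairing
import Literature.NumberTheory.GaloisRepresentations.IdeleClassBarInvariantSubgroup
import Literature.NumberTheory.GaloisRepresentations.GalLayerSystemSESLayers
import Literature.NumberTheory.GaloisRepresentations.GalLayerSystemColimit
import Literature.NumberTheory.GaloisRepresentations.GalLayerSystemUnitsBar
import Literature.NumberTheory.GaloisRepresentations.IdeleCohomologyLimit
import Literature.NumberTheory.GaloisRepresentations.IdeleClassH2Sequence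
import Literature.NumberTheory.NumberFields.CyclicCyclotomicExtensionExists
import Literature.Algebra.Homology.DiscreteRepGaloisCorollaries
import HarnessLib

/-!
# `H³(F, F̄ˣ) = 0` for a number field (Tate), hence (hH3), hence `stub_realThreeOrderTwoBase` and Milne I 4.10 (c)₃
# (K4 `SignedControlAtTwo`, stmt-BirchSwinnertonDyer-20309, line `eulerchar`, stub 3)

Route `ThetaPartnerAtTwo` (TP2; crux shared with `ResidualThetaTransportAtTwo`), crux K4 `SignedControlAtTwo`, line `eulerchar`
(skeleton v15), stub `stub_realThreeOrderTwoBase` (the base case `H³(F, ℤ/2) ↪ ⊕_{w real} H³(F_w, ℤ/2)` of Milne I Thm. 4.10 (c)₃).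
Seat `prover-bsd-wall-tp2-p3-w3` (width 3/3, gen 9), brick (hH3) of the lead's owner table (11:03Z).  The lead's B7
(`…ShaThreeBaseOfBrauer`) reduced the stub to (hH3) `H³(F, F̄ˣ)[2] = 0` + (hBr); (hBr) is `…ShaThreeBaseBrauerDivisible`
(this seat, p627011).  THIS FILE PROVES (hH3) — indeed the full vanishing **`H³(Γ_F, F̄ˣ) = 0`** (Tate; Cassels–Fröhlich VII §11.4,
Harari Cor. 13.2 / Thm. 16.21 setting) — from the idèle class formation of cell bsd-schneider, in door-c4's `Ext` dialect:

* §1 `ext_three_ideleBarD_eq_zero` — `Ext³_{C_Γ}(ℤ, J̄) = 0`: every class is inflated from a layer `H³(Gal(E/F), J_E)`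
  (`GalLayerData.exists_inflLayer_eq`), which is `0` (door-c5 `IdeleCohomology.isZero_H3_ideleRep`, Harari Cor. 13.2).
* §2 `inflLayer_ideleData_comp_limitHom` (the inflations intertwine `J̄ → C̄` with `H²(classRepHom)`; door-c4 `LayerColimit.inflG_map`
  + door-c5 `functor_map_ideleToClass_comp_layerCohomologyIso`) and **`exists_ext_two_ideleBarD_comp_eq`** — `Ext²(ℤ, J̄) → Ext²(ℤ, C̄)`
  is ONTO: `inv_F` is injective on `Ext²(ℤ, C̄)` (`IdeleClassBar.classBarInv_injective`), every `t ∈ ℚ/ℤ` is the invariant of an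
  idèle class of a CYCLIC layer of degree divisible by the order of `t` (`exists_isCyclic_dvd_finrank`, `range_classInvAll`,
  `ideleToClass_surjective_of_isCyclic`, `classInvAll_ideleToClass` via `classBarInv_inflG_layerCohomologyIso_inv`).
* §3 **`ext_three_unitsBarD_eq_zero`** — `Ext³_{C_Γ}(ℤ, lim→ Eˣ) = 0` from the covariant `Ext` sequence of
  `0 → lim→ Eˣ → J̄ → C̄ → 0` (`ideleClassLimitShortComplex_shortExact`; Mathlib `Ext.covariant_sequence_exact₁`, `ShortExact.comp_extClass`);
  **`galoisCohomology_units_three_eq_zero`** — `H³(Γ_F, F̄ˣ) = 0` in the tree's cochain Galois cohomology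
  (`unitsBarIso`, `DiscreteRep.extTrivAddEquivGaloisCohomology`).
* §4 (hH3) `units_three_two_torsion_eq_zero`; **`stub_realThreeOrderTwoBase`** — THE REGISTERED STUB VERBATIM (from
  `realThree_injective_orderTwo_of_H3`); **`poitouTate_three_realPlaces_injective_holds`** — Milne I Thm. 4.10 (c)₃
  `poitouTate_three_realPlaces_injective K` for EVERY number field `K`.

HONEST FRAMING: theorems only (no definition, no named fact, no `sorry`); classical class field theory (Tate 1967) assembled from the
tree; closes stub 3 of line `eulerchar` if the gate matches the signature; the crux K4 still has stub 2 (`stub_poitouTateShaRat`);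
BSD is not proved by any of this.

References: [CasselsFrohlichANT1967] Ch. VII (Tate) §11.4 (`H³(G_K, K̄ˣ)`... ) and §7.3 Cor. 7.4; [Harari2020] Cor. 13.2, Thm. 13.23;
[MilneADT2006] I Thm. 4.10 (c).
-/

set_option autoImplicit false
-- the Theorems namespace of this sub repeats the summit name by design (D-0017 nested layout)
set_option linter.dupNamespace false

noncomputable section

open CategoryTheory CategoryTheory.Abelian NumberField Field Function groupCohomology
open Literature.NumberTheory.GaloisRepresentations
open Literature.NumberTheory.GaloisRepresentations.IdeleClassBar
open Literature.NumberTheory.GaloisRepresentations.DiscreteGaloisModule (units)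
open Literature.NumberTheory.GaloisCohomology
open Literature.NumberTheory.NumberFields
open Literature.NumberTheory.Automorphic
open Literature.AnabelianGeometry.AbsoluteAnabelian.Prop121vii
open Literature.Algebra.Homology Literature.Algebra.Homology.DiscreteRep
open scoped Classical

namespace Summit.BirchSwinnertonDyer.BirchSwinnertonDyer.Theorems.SignedEC.ShaThreeBrauer

variable (F : Type) [Field F] [NumberField F]

/-! ## §1 `Ext³_{C_Γ}(ℤ, J̄) = 0` -/

section IdeleThree

/-- **`Ext³_{C_Γ}(ℤ, J̄) = 0`**: every class of the limit is inflated from some `H³(Gal(E/F), J_E)`, and these vanish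
(Harari Cor. 13.2: `H³(G, I_K) = 0`; door-c5 `isZero_H3_ideleRep`). [cite: Harari2020, Corollary 13.2]
[cite: CasselsFrohlichANT1967, Ch. VII §7.3 Cor. 7.4] -/
theorem ext_three_ideleBarD_eq_zero [CompactSpace (absoluteGaloisGroup F)] [TotallyDisconnectedSpace (absoluteGaloisGroup F)]
    (y : Ext (triv (k := ℤ) (Γ := absoluteGaloisGroup F) ℤ) (ideleBarD F) 3) : y = 0 := by
  obtain ⟨E, c, rfl⟩ := (ideleData F).exists_inflLayer_eq 3 y
  haveI := E.numberField
  haveI := E.isGalois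
  haveI : Subsingleton (groupCohomology ((ideleData F).obj E) 3) := by
    rw [ideleData_obj]
    exact ModuleCat.subsingleton_of_isZero (IdeleCohomology.isZero_H3_ideleRep (F := F) (E := E.1))
  rw [Subsingleton.elim c 0, map_zero]

end IdeleThree

/-! ## §2 `Ext²(ℤ, J̄) → Ext²(ℤ, C̄)` is onto -/

section IdeleToClassTwo

/-- Every `t ∈ ℚ/ℤ` is killed by a positive integer. [folklore] -/
private theorem exists_nsmul_eq_zero' (t : AddCircle (1 : ℚ)) : ∃ N : ℕ, 0 < N ∧ N • t = 0 := by
  induction t using QuotientAddGroup.induction_on with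
  | H q =>
    refine ⟨q.den, q.den_pos, ?_⟩
    change q.den • ((q : ℚ) : AddCircle (1 : ℚ)) = 0
    rw [← AddCircle.coe_nsmul, nsmul_eq_mul, Rat.den_mul_eq_num, ← zsmul_one, AddCircle.coe_zsmul,
      AddCircle.coe_period, smul_zero]

/-- **The layer inflations intertwine `J̄ → C̄` with `H²(Gal(E/F), J_E → C_E)`**:
`Inf_E(x) ∘ (J̄ → C̄) = Inf_E(H²(classRepHom) x)` (door-c4 `inflG_map` + door-c5 `functor_map_ideleToClass_comp_layerCohomologyIso`).
[cite: CasselsFrohlichANT1967, Ch. VII §11.1] -/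
theorem inflLayer_ideleData_comp_limitHom [CompactSpace (absoluteGaloisGroup F)] [TotallyDisconnectedSpace (absoluteGaloisGroup F)]
    (E : GalLayer F) (n : ℕ) (x : groupCohomology ((ideleData F).obj E) n) :
    ((ideleData F).inflLayer E n x).comp (Ext.mk₀ (ideleToClass F).limitHom) (add_zero n) =
      (classData F).inflLayer E n
        ((groupCohomology.functor ℤ (E.1 ≃ₐ[F] E.1) n).map
          (haveI := E.numberField; IdeleClassGroup.classRepHom F E.1) x) := by
  rw [GalLayerData.inflLayer_apply, GalLayerData.inflLayer_apply, ← LayerColimit.inflG_map]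
  congr 1
  -- `(J̄ → C̄)^{U_E}_* (iso_J⁻¹ x) = iso_C⁻¹ (H²(classRepHom) x)`
  have h := congrArg
    (fun φ : groupCohomology ((ideleData F).layerRep E) n ⟶ groupCohomology ((classData F).obj E) n =>
      φ (((ideleData F).layerCohomologyIso E n).inv x))
    (functor_map_ideleToClass_comp_layerCohomologyIso F E n)
  change ((classData F).layerCohomologyIso E n).hom
      (((groupCohomology.functor ℤ (absoluteGaloisGroup F ⧸ (E.openNormalSubgroup : Subgroup (absoluteGaloisGroup F))) n).map
        ((DiscreteRep.invariantsQuotFunctor ℤ (E.openNormalSubgroup : Subgroup (absoluteGaloisGroup F))).map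
          (ideleToClass F).limitHom))
        (((ideleData F).layerCohomologyIso E n).inv x)) =
    ((groupCohomology.functor ℤ (E.1 ≃ₐ[F] E.1) n).map (haveI := E.numberField; IdeleClassGroup.classRepHom F E.1))
      (((ideleData F).layerCohomologyIso E n).hom (((ideleData F).layerCohomologyIso E n).inv x)) at h
  rw [Iso.inv_hom_id_apply] at h
  apply ((classData F).layerCohomologyIso E n).toLinearEquiv.injective
  change ((classData F).layerCohomologyIso E n).hom _ =
    ((classData F).layerCohomologyIso E n).hom (((classData F).layerCohomologyIso E n).inv _)
  rw [Iso.inv_hom_id_apply]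
  exact h

/-- **`Ext²_{C_Γ}(ℤ, J̄) → Ext²_{C_Γ}(ℤ, C̄)` is surjective** (`H²(Γ_F, J̄) ↠ H²(Γ_F, C̄)`): `inv_F` is injective on
`Ext²(ℤ, C̄)`, and every `t ∈ ℚ/ℤ` is `inv_F` of the image of an idèle class — at a CYCLIC layer `E/F` of degree divisible by the
order of `t` the class map `H²(J_E) → H²(C_E)` is onto and `inv_{E/F}` takes every value of `(1/[E:F])ℤ/ℤ`.
[cite: CasselsFrohlichANT1967, Ch. VII §11.2 (bis)] [cite: Harari2020, Theorem 13.23] -/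
theorem exists_ext_two_ideleBarD_comp_eq [CompactSpace (absoluteGaloisGroup F)] [TotallyDisconnectedSpace (absoluteGaloisGroup F)]
    (c : Ext (triv (k := ℤ) (Γ := absoluteGaloisGroup F) ℤ) (ideleClassLimitShortComplex F).X₃ 2) :
    ∃ j : Ext (triv (k := ℤ) (Γ := absoluteGaloisGroup F) ℤ) (ideleClassLimitShortComplex F).X₂ 2,
      j.comp (Ext.mk₀ (ideleClassLimitShortComplex F).g) (add_zero 2) = c := by
  change ∃ j : Ext (triv (k := ℤ) (Γ := absoluteGaloisGroup F) ℤ) (ideleBarD F) 2,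
    j.comp (Ext.mk₀ (ideleToClass F).limitHom) (add_zero 2) = c
  -- the order of `inv_F c`
  obtain ⟨N, hN, hNt⟩ := exists_nsmul_eq_zero' (classBarInvD F c)
  -- a cyclic layer of degree divisible by `N`
  obtain ⟨L, hfin, hgal, hcyc, hdvd⟩ := exists_isCyclic_dvd_finrank (F := F) hN.ne'
  haveI := hfin
  haveI := hgal
  let E : GalLayer F := ⟨L, hfin, hgal⟩
  haveI := E.numberField
  haveI : IsGalois F E.1 := hgal
  haveI : IsCyclic (E.1 ≃ₐ[F] E.1) := hcyc
  haveI : NeZero (Module.finrank F E.1) := ⟨Module.finrank_pos.ne'⟩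
  -- `inv_F c` is a value of `inv_{E/F}`
  have hnt : Module.finrank F E.1 • classBarInvD F c = 0 := by
    obtain ⟨k, hk⟩ := hdvd
    change Module.finrank F L • classBarInvD F c = 0
    rw [hk, mul_comm, ← smul_smul, hNt, smul_zero]
  obtain ⟨a, ha⟩ := UnitsLayer.mem_range_zmodToQmodZ_of_nsmul_eq_zero (Module.finrank F E.1) (classBarInvD F c) hnt
  have hmem : zmodToQmodZ (Module.finrank F E.1) a ∈ Set.range (IdeleCohomology.classInvAll F E.1) := by
    rw [IdeleCohomology.range_classInvAll]
    exact ⟨a, rfl⟩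
  obtain ⟨y, hy⟩ := hmem
  -- `y` is the image of an idèle class (cyclic layer)
  obtain ⟨jE, hjE⟩ := IdeleCohomology.ideleToClass_surjective_of_isCyclic (F := F) (E := E.1) y
  refine ⟨(ideleData F).inflLayer E 2 jE, classBarInvD_injective F ?_⟩
  -- `inv_F` of an inflated layer class is the layer invariant
  have key : ∀ y' : groupCohomology ((classData F).obj E) 2,
      classBarInvD F ((classData F).inflLayer E 2 y') = IdeleCohomology.classInvAll F E.1 y' := fun y' => by
    rw [GalLayerData.inflLayer_apply]
    exact (LayerColimit.desc_inflG (isCompatibleFamily_layerInvD F) E _).trans (layerInvD_iso_inv F E y')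
  have hmap : (groupCohomology.functor ℤ (E.1 ≃ₐ[F] E.1) 2).map (IdeleClassGroup.classRepHom F E.1) jE =
      IdeleCohomology.ideleToClass F E.1 jE := by
    rw [groupCohomology.functor_map, IdeleCohomology.ideleToClass_apply]
    rfl
  rw [inflLayer_ideleData_comp_limitHom, key]
  refine (congrArg (IdeleCohomology.classInvAll F E.1) hmap).trans ?_
  rw [hjE, hy, ha]

end IdeleToClassTwo

/-! ## §3 `H³(Γ_F, F̄ˣ) = 0` -/

section UnitsThree

/-- **`Ext³_{C_Γ}(ℤ, lim→ Eˣ) = 0`**: in the covariant `Ext` sequence of `0 → lim→ Eˣ → J̄ → C̄ → 0`,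
`Ext²(J̄) ↠ Ext²(C̄) → Ext³(lim Eˣ) → Ext³(J̄) = 0`. [cite: CasselsFrohlichANT1967, Ch. VII §11.4] [cite: Harari2020, Corollary 13.2] -/
theorem ext_three_unitsBarD_eq_zero [CompactSpace (absoluteGaloisGroup F)] [TotallyDisconnectedSpace (absoluteGaloisGroup F)]
    (e : Ext (triv (k := ℤ) (Γ := absoluteGaloisGroup F) ℤ) (unitsBarD F) 3) : e = 0 := by
  have hS := ideleClassLimitShortComplex_shortExact F
  have h1 : e.comp (Ext.mk₀ (ideleClassLimitShortComplex F).f) (add_zero 3) = 0 :=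
    ext_three_ideleBarD_eq_zero F _
  obtain ⟨c, hc⟩ := Ext.covariant_sequence_exact₁ (triv (k := ℤ) (Γ := absoluteGaloisGroup F) ℤ) hS e h1 (n₀ := 2) rfl
  obtain ⟨j, hj⟩ := exists_ext_two_ideleBarD_comp_eq F c
  rw [← hc, ← hj, Ext.comp_assoc_of_second_deg_zero, hS.comp_extClass, Ext.comp_zero]
  rfl

/-- **`H³(Γ_F, F̄ˣ) = 0` for every number field `F`** (Tate), in the tree's cochain Galois cohomology `galoisCohomology (units F) 3`:
transport of `ext_three_unitsBarD_eq_zero` along `unitsBarIso : lim→ Eˣ ≅ F̄ˣ` and `Ext³_{C_Γ}(ℤ, F̄ˣ) ≃ H³(Γ_F, F̄ˣ)`.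
[cite: CasselsFrohlichANT1967, Ch. VII §11.4] [cite: Harari2020, Corollary 13.2] -/
theorem galoisCohomology_units_three_eq_zero (z : galoisCohomology (units F) 3) : z = 0 := by
  haveI : CompactSpace (absoluteGaloisGroup F) := absoluteGaloisGroup_compactSpace F
  set e := (extTrivAddEquivGaloisCohomology (units F) 3).symm z with he
  have hz : z = extTrivAddEquivGaloisCohomology (units F) 3 e := by rw [he, AddEquiv.apply_symm_apply]
  -- move `e` to `Ext³(ℤ, unitsBarD F)` and back
  have h0 : e.comp (Ext.mk₀ (unitsBarIso F).inv) (add_zero 3) = 0 := ext_three_unitsBarD_eq_zero F _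
  have he0 : e = 0 := by
    have h1 : (e.comp (Ext.mk₀ (unitsBarIso F).inv) (add_zero 3)).comp (Ext.mk₀ (unitsBarIso F).hom) (add_zero 3) = e := by
      rw [Ext.comp_assoc_of_second_deg_zero, Ext.mk₀_comp_mk₀, Iso.inv_hom_id, Ext.comp_mk₀_id]
    rw [← h1, h0, Ext.zero_comp]
  rw [hz, he0, map_zero]

end UnitsThree

/-! ## §4 (hH3), the stub, and Milne I 4.10 (c)₃ -/

section Consequences

/-- **(hH3) `H³(F, F̄ˣ)[2] = 0`** — the hypothesis of B7 `ShaThree.realThree_injective_orderTwo_of_brauer`, trivially from §3.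
[cite: CasselsFrohlichANT1967, Ch. VII §11.4] -/
theorem units_three_two_torsion_eq_zero (z : galoisCohomology (units F) 3) (_h : z + z = 0) : z = 0 :=
  galoisCohomology_units_three_eq_zero F z

/-- **The registered stub `stub_realThreeOrderTwoBase` of line `eulerchar` (K4 `SignedControlAtTwo`), VERBATIM**: for every number
field `F` and every discrete `Γ_F`-module `T` of order `2` with trivial action, a class of `H³(F, T)` vanishing at all real places
is `0` — `realThree_injective_orderTwo_of_H3` (B7 + (hBr)) with (hH3) = `units_three_two_torsion_eq_zero`.
[cite: MilneADT2006, Ch. I, Thm. 4.10 (c)] [cite: CasselsFrohlichANT1967, Ch. VII §11] -/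
theorem stub_realThreeOrderTwoBase :
    ∀ (F : Type) [Field F] [NumberField F] (T : Type) [AddCommGroup T] [TopologicalSpace T]
      [DiscreteTopology T] [Finite T] (σ : DiscreteGaloisModule F T),
      (∀ (g : Field.absoluteGaloisGroup F) (t : T), σ g t = t) → Nat.card T = 2 →
        ∀ c : galoisCohomology σ 3,
          (∀ w : NumberField.InfinitePlace F, w.IsReal →
            galoisCohomology.localization σ (Sum.inl w) 3 c = 0) → c = 0 :=
  fun F _ _ T _ _ _ _ σ htriv hcard =>
    realThree_injective_orderTwo_of_H3 F (units_three_two_torsion_eq_zero F) T σ htriv hcard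

/-- **Milne I Thm. 4.10 (c), `r = 3`: `poitouTate_three_realPlaces_injective K` HOLDS for every number field `K`**
(`poitouTate_three_realPlaces_injective_of_H3` with (hH3) discharged). [cite: MilneADT2006, Ch. I, Thm. 4.10 (c)] -/
theorem poitouTate_three_realPlaces_injective_holds :
    ∀ (K : Type) [Field K] [NumberField K], poitouTate_three_realPlaces_injective K :=
  fun K _ _ => poitouTate_three_realPlaces_injective_of_H3 K fun F _ _ => units_three_two_torsion_eq_zero F

end Consequences

end Summit.BirchSwinnertonDyer.BirchSwinnertonDyer.Theorems.SignedEC.ShaThreeBrauer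

end
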